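import Literature.NumberTheory.LFunctions.Zhang2022.Section12LogFreeCore
import Literature.NumberTheory.LFunctions.Zhang2022.RepairGapLemma84Premise
import HarnessLib

/-!
# Zhang (2022), rescue GAP/BED (D-0124 (3)(4)): §12 (12.11)/(12.25) — the log-free contour core of the mid range under the
# minimum premise `‖L(1,χ)‖ ≤ 𝓛⁻¹⁵`

Topic `Literature/NumberTheory/LFunctions/Zhang2022` (Landau–Siegel audit tree; verdict-neutral).
Y. Zhang, *Discrete mean estimates and the Landau–Siegel zero*, arXiv:2211.02515v1 (2022)
[Zhang2022LandauSiegel] — **an unrefereed manuscript under adjudication; nothing in this file asserts or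
denies its Theorems 1–2, and nothing here is a claim about Landau–Siegel zeros. The programme SEARCHES and
TYPES; no claim about Landau–Siegel zeros, Theorems 1–2 of arXiv:2211.02515 or a repaired Margin232 until a
kernel theorem says so.**

The tree's log-free core `Lemma84.logfree_core` (file `Section12LogFreeCore`; the difference of two logarithmic Riesz means of
`χ(n)ξ₀ⱼ(n;d,r)n^{β_μ−1}` at `T < y′ ≤ y`, the engine behind the mid-range node `Mid1225` via `logfree_mid_bound` /
`sum122_mid_bound_of_logfree`) takes the printed (A) `‖L(1,χ)‖ ≤ 𝓛⁻²⁰²²` and uses it at ONE place only: the comparison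
`Lemma84.norm_Phi_sub_model_le` (Lemma 5.8 inside), whose `𝓛⁻¹⁵` twin is `Repair.Gap.norm_Phi_sub_model_le_pow15` (p572334).
This file is the tree proof VERBATIM with that hypothesis swap and the one call replaced: `Lemma84.logfree_core_pow15` — same
explicit pieces, same constants. First input of the Mid1225 chain at exponent 15. Theorems only; no definition, no named fact;
nothing about (A) itself.

## References

* Y. Zhang, arXiv:2211.02515v1 (2022), §12 (12.11) p. 70, (12.25) p. 72; §8 Lemma 8.4 (proof); §5 Lemma 5.8.
  [cite: Zhang2022LandauSiegel, §12 (12.11) p.70] [cite: MontgomeryVaughan2007, §6.2, Thm 11.4]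
-/

noncomputable section

open Complex Real Set Finset

namespace Literature.NumberTheory.LFunctions.Zhang2022.Lemma84

open Skeleton Literature.Analysis.Complex

section Core

variable {D : ℕ} [NeZero D] (χ : DirichletCharacter ℂ D) (c' : ℝ)

set_option maxHeartbeats 800000 in
/-- **The log-free core under the minimum premise** (twin of `Lemma84.logfree_core`, same explicit pieces): all hypotheses as
there except `‖L(1,χ)‖ ≤ 𝓛⁻²⁰²²` replaced by `‖L(1,χ)‖ ≤ 𝓛⁻¹⁵` — the only use of the premise is the model comparison, taken
through `Repair.Gap.norm_Phi_sub_model_le_pow15`. [cite: Zhang2022LandauSiegel, §12 (12.11) p.70; §8 Lemma 8.4 (proof)]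
[cite: MontgomeryVaughan2007, §6.2, Thm 11.4] -/
theorem logfree_core_pow15 (hχ1 : χ ≠ 1) (hprim : χ.IsPrimitive) (h𝓛 : 3 ≤ Real.log D)
    (h15 : ‖χ.LFunction 1‖ ≤ 1 / Real.log D ^ 15) (j μ : ℕ) {d r : ℕ} (hd : d ≠ 0) (hr : r ≠ 0)
    {y y' : ℝ} (hy'T : bigT D < y') (hyy' : y' ≤ y) (hlog1 : Real.log y - Real.log y' ≤ 1)
    (U : ℂ → ℂ) {ρ η MU BL Minv C₈₃ K ℓ₀ : ℝ}
    (hUd : DifferentiableOn ℂ U {s : ℂ | 9 / 10 < s.re})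
    (hU1 : ∀ s : ℂ, 1 < s.re → U s = χ.LFunction s /
      (χ.LFunction (s + betaJ c' D (j + 1)) * χ.LFunction (s + betaJ c' D (j + 2))) *
        xiSeries c' χ j d r s)
    (hMU : 0 ≤ MU) (hU : ∀ w : ℂ, 1 - η ≤ w.re → ‖U w‖ ≤ MU) (hC₈₃ : 0 ≤ C₈₃)
    (hU3 : ∀ s : ℂ, ‖s - 1‖ ≤ 5 * alpha D → ‖U s - PiW χ d r‖ ≤
      C₈₃ * (ell D ^ 8)⁻¹ * ∏ q ∈ (d * r).primeFactors, (1 - (q : ℝ)⁻¹)⁻¹)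
    (hαη : alpha D ≤ η) (hη40 : η ≤ 1 / 40) (hBL : 0 ≤ BL)
    (hL : ∀ s : ℂ, 1 - η ≤ s.re → ‖s‖ ≤ (D : ℝ) + 4 → ‖χ.LFunction s‖ ≤ BL) (hMinv : 0 ≤ Minv)
    (hpack : ∀ s : ℂ, 1 - 2 * η ≤ s.re → |s.im| ≤ (D : ℝ) + 1 → s ≠ (ρ : ℂ) →
      χ.LFunction s ≠ 0 ∧ ‖(χ.LFunction s)⁻¹‖ ≤ Minv * (1 + ‖s - ρ‖⁻¹))
    (hρ1 : ρ < 1) (hρη : 1 - η / 2 ≤ ρ) (hρα : 1 - alpha D / 2 < ρ) (hLρ : χ.LFunction ρ = 0)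
    (hL'ρ : deriv χ.LFunction ρ ≠ 0) (hℓ₀ : 0 < ℓ₀) (hℓ : ℓ₀ ≤ ‖deriv χ.LFunction 1‖)
    (hK : 7 + 15 * |c'| ≤ K) (hKL : K * π ≤ Real.log D ^ 8)
    (hE : (1 + 16 * Real.exp (9 / 2) * π ^ 2 * K ^ 2) / Real.log D ^ 15 ≤ ℓ₀ * alpha D / 4) :
    ‖(∑ n ∈ Finset.Ioc 0 ⌊y⌋₊,
          (χ (n : ZMod D) * xiZero c' D j n d r * (n : ℂ) ^ (betaMu D μ - 1)) *
            (Real.log (y / n) : ℂ)) -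
        ∑ n ∈ Finset.Ioc 0 ⌊y'⌋₊,
          (χ (n : ZMod D) * xiZero c' D j n d r * (n : ℂ) ^ (betaMu D μ - 1)) *
            (Real.log (y' / n) : ℂ)‖ ≤
      1 / (2 * π) * (4 * (Real.exp (alpha D * Real.log y) * (MU * ((1 + alpha D) / alpha D) ^ 3) / D) +
        2 * (Real.exp (-η * Real.log y') * (MU * BL * BL * (Minv * (1 + 2 / η))) * (π / η)) +
        4 * ((alpha D + η) * (Real.exp (alpha D * Real.log y) * (MU * BL * BL * (Minv * 3)) /
          (D : ℝ) ^ 2)) +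
        672 * (Real.log y - Real.log y') * Real.exp (alpha D * Real.log y / 2) *
          ((∏ q ∈ (d * r).primeFactors, (1 - (q : ℝ)⁻¹)⁻¹) ^ 2 *
              ((1 + 16 * Real.exp (9 / 2) * π ^ 2 * K ^ 2) / Real.log D ^ 15) * (24 * K ^ 2 + 2 * K) +
            32 * K ^ 3 * (C₈₃ * (ell D ^ 8)⁻¹ * ∏ q ∈ (d * r).primeFactors, (1 - (q : ℝ)⁻¹)⁻¹) *
              (2 * Real.exp (9 / 2) * (1 + Real.log D) * Real.log D) * alpha D +
            (2 * Real.exp (9 / 2) * (1 + Real.log D) * Real.log D) *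
              (∏ q ∈ (d * r).primeFactors, (1 - (q : ℝ)⁻¹)⁻¹) ^ 2 * (2 * K ^ 2 * alpha D))) := by
  set α : ℝ := alpha D with hαdef
  set βμ : ℂ := betaMu D μ with hβμdef
  set βa : ℂ := betaJ c' D (j + 1) with hβadef
  set βb : ℂ := betaJ c' D (j + 2) with hβbdef
  have hℓ2 : 2 ≤ ell D := by rw [ell]; linarith
  have hα0 : 0 < α := alpha_pos' (by linarith)
  have hη0 : 0 < η := lt_of_lt_of_le hα0 hαη
  have hαℓ : α * ell D ≤ 1 := alpha_mul_ell_le_one hℓ2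
  have hα1 : α ≤ 1 := by
    have h1 : 1 ≤ ell D := by linarith
    nlinarith
  have hβμre : βμ.re = 0 := betaMu_re D μ
  have hβare : βa.re = 0 := betaJ_re c' D _
  have hβbre : βb.re = 0 := betaJ_re c' D _
  obtain ⟨hβμ1, hβμ2⟩ := betaMu_im_bounds D μ hα0.le
  rw [← hβμdef, ← hαdef] at hβμ1 hβμ2
  have hβμn : ‖βμ‖ ≤ 1 / 2 := by
    rw [norm_betaMu D μ hα0.le, ← hβμdef]
    have : η ≤ 1 / 40 := hη40
    nlinarith
  have hβn : ∀ i : ℕ, ‖betaJ c' D i‖ ≤ 1 := by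
    intro i
    have h := norm_betaJ_le c' D i hα0.le (by linarith : 0 ≤ ell D)
    refine h.trans ?_
    have h1 : 5 * |c'| * alpha D * ell D ≤ 5 * |c'| := by
      calc 5 * |c'| * alpha D * ell D = 5 * |c'| * (alpha D * ell D) := by ring
        _ ≤ 5 * |c'| * 1 := by gcongr
        _ = 5 * |c'| := mul_one _
    have hKα : K * α ≤ 1 := by
      rw [hαdef, alpha_eq]
      have h9 : Real.log D ^ 9 = Real.log D ^ 8 * Real.log D := by ring
      rw [mul_div_assoc', div_le_one (by positivity), h9]
      calc K * π ≤ Real.log D ^ 8 := hKL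
        _ = Real.log D ^ 8 * 1 := (mul_one _).symm
        _ ≤ Real.log D ^ 8 * Real.log D := by gcongr; linarith
    rw [← hαdef] at h1 ⊢
    nlinarith [abs_nonneg c']
  -- the integrand
  set Φ : ℂ → ℂ := fun u => U (1 - βμ + u) * χ.LFunction (1 - βμ + u + βa) *
    χ.LFunction (1 - βμ + u + βb) / χ.LFunction (1 - βμ + u) with hΦdef
  have hΦ : ∀ u, Φ u = U (1 - βμ + u) * χ.LFunction (1 - βμ + u + βa) *
      χ.LFunction (1 - βμ + u + βb) / χ.LFunction (1 - βμ + u) := fun u => rfl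
  set f : ℕ → ℂ := fun n => χ (n : ZMod D) * xiZero c' D j n d r * (n : ℂ) ^ (βμ - 1) with hfdef
  -- sizes of `y, y'`
  have hT1 : 1 < bigT D := by rw [bigT]; exact Real.one_lt_exp_iff.2 (by positivity)
  have hy'1 : 1 ≤ y' := by linarith
  have hy1 : 1 ≤ y := by linarith
  have hy0 : 0 < y := by linarith
  -- the three `Φ`-bounds
  have hPhiR : ∀ u : ℂ, α ≤ u.re → χ.LFunction (1 - βμ + u) ≠ 0 ∧
      ‖Φ u‖ ≤ MU * ((1 + α) / α) ^ 3 := fun u hu =>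
    norm_Phi_right_le χ U Φ βμ βa βb hα0 hβμre hβare hβbre hΦ hMU
      (fun w hw => hU w (by linarith)) hu
  have hPhiL : ∀ t : ℝ, |t| ≤ (D : ℝ) → ‖Φ (((-η : ℝ) : ℂ) + t * I)‖ ≤
      MU * BL * BL * (Minv * (1 + 2 / η)) := fun t ht =>
    norm_Phi_left_le χ U Φ βμ βa βb hη0 (by linarith) hβμre hβμn hβare (hβn _) hβbre (hβn _)
      hΦ hMU hU hBL hL hMinv hpack hρη ht
  have hD2 : (2 : ℝ) ≤ D := by
    have h3 : Real.exp 3 ≤ D := by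
      have hD0 : (0 : ℝ) < D := by
        rcases lt_or_ge 0 (D : ℝ) with h | h
        · exact h
        · have : Real.log (D : ℝ) ≤ 0 := by
            have : (D : ℝ) = 0 := le_antisymm h (Nat.cast_nonneg D)
            rw [this, Real.log_zero]
          linarith
      exact (Real.le_log_iff_exp_le hD0).1 h𝓛
    have : (2 : ℝ) ≤ Real.exp 3 := by
      have := Real.add_one_le_exp (3 : ℝ); linarith
    linarith
  have hPhiH : ∀ x' y'' : ℝ, -η ≤ x' → x' ≤ α → |y''| = (D : ℝ) →
      ‖Φ ((x' : ℂ) + y'' * I)‖ ≤ MU * BL * BL * (Minv * 3) := fun x' y'' h1 h2 h3 =>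
    norm_Phi_horiz_le χ U Φ βμ βa βb hη0 (by linarith) hα1 hD2 hβμre hβμn hβare (hβn _)
      hβbre (hβn _) hΦ hMU hU hBL hL hMinv hpack h1 h2 h3
  -- the zero-free box (strict form)
  have hzf : ∀ w : ℂ, 1 - 2 * η < w.re → |w.im| < (D : ℝ) + 1 → w ≠ ρ →
      χ.LFunction w ≠ 0 := fun w h1 h2 h3 => (hpack w h1.le h2.le h3).1
  -- the Dirichlet series
  have hf9 : LSeriesSummable f 9 :=
    LSeriesSummable_coeff c' χ j μ d r (u := 9) (by rw [Complex.re_ofNat]; norm_num)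
  have hfΦ : ∀ t : ℝ, LSeries f ((9 : ℝ) + t * I) = Φ ((9 : ℝ) + t * I) := by
    intro t
    have h9 : (8 : ℝ) < (((9 : ℝ) : ℂ) + t * I).re := by simp; norm_num
    rw [LSeries_coeff_eq_xiSeries c' χ j μ d r h9, hΦ]
    set w : ℂ := 1 - βμ + (((9 : ℝ) : ℂ) + t * I) with hw
    have hwre : w.re = 10 := by simp [hw, hβμre]; norm_num
    have hw1 : 1 < w.re := by rw [hwre]; norm_num
    have hne : ∀ β : ℂ, β.re = 0 → χ.LFunction (w + β) ≠ 0 := fun β hβ =>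
      (inv_LFunction_le_right χ (a := 9) (by norm_num) (s := w + β)
        (by simp [hwre, hβ]; norm_num)).1
    have hne0 : χ.LFunction w ≠ 0 := by
      have := hne 0 (by simp); rwa [add_zero] at this
    have hna := hne βa hβare
    have hnb := hne βb hβbre
    rw [hU1 w hw1]
    field_simp
  -- the small-rectangle supremum of `Φ`
  set hatPi : ℝ := ∏ q ∈ (d * r).primeFactors, (1 - (q : ℝ)⁻¹)⁻¹ with hhatPi
  set Δ : ℝ := hatPi ^ 2 * ((1 + 16 * Real.exp (9 / 2) * π ^ 2 * K ^ 2) / Real.log D ^ 15) *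
      (24 * K ^ 2 + 2 * K) + 32 * K ^ 3 * (C₈₃ * (ell D ^ 8)⁻¹ * hatPi) *
      (2 * Real.exp (9 / 2) * (1 + Real.log D) * Real.log D) * α with hΔdef
  set Mmod : ℝ := (2 * Real.exp (9 / 2) * (1 + Real.log D) * Real.log D) * hatPi ^ 2 *
      (2 * K ^ 2 * α) with hMmod
  have hhatPi0 : 0 ≤ hatPi := Finset.prod_nonneg fun q hq => by
    have hq2 : (2 : ℝ) ≤ q := by exact_mod_cast (Nat.prime_of_mem_primeFactors hq).two_le
    have : (q : ℝ)⁻¹ ≤ 1 / 2 := by rw [inv_eq_one_div]; gcongr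
    exact inv_nonneg.2 (by linarith)
  have hK0 : 0 ≤ K := by linarith [abs_nonneg c']
  have hlogD0 : 0 ≤ Real.log D := by linarith
  have hΔ0 : 0 ≤ Δ := by rw [hΔdef]; positivity
  have hMmod0 : 0 ≤ Mmod := by rw [hMmod]; positivity
  have hPhiC : ∀ u : ℂ, u.re ∈ Icc (-(α / 2)) (α / 2) →
      u.im ∈ Icc (βμ.im - 3 * α) (βμ.im + 3 * α) → (|u.re| = α / 2 ∨ |u.im - βμ.im| = 3 * α) →
      ‖Φ u‖ ≤ Δ + Mmod := by
    intro u hre him hbd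
    have hcmp := Repair.Gap.norm_Phi_sub_model_le_pow15 χ c' hprim h𝓛 h15 j μ hd hr U hC₈₃ hK hKL hℓ₀ hℓ
      hE hU3
      hre him hbd
    have hmod := norm_model_bdry_le χ c' hprim h𝓛 j μ hd hr hK hre him hbd
    rw [hΦ u]
    have htri := norm_le_norm_add_norm_sub'
      (U (1 - βμ + u) * χ.LFunction (1 - βμ + u + βa) * χ.LFunction (1 - βμ + u + βb) /
        χ.LFunction (1 - βμ + u))
      (deriv χ.LFunction 1 * PiW χ d r * (u + (βa - βμ)) * (u + (βb - βμ)) / (u - βμ))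
    calc _ ≤ ‖deriv χ.LFunction 1 * PiW χ d r * (u + (βa - βμ)) * (u + (βb - βμ)) / (u - βμ)‖ +
          ‖U (1 - βμ + u) * χ.LFunction (1 - βμ + u + βa) * χ.LFunction (1 - βμ + u + βb) /
              χ.LFunction (1 - βμ + u) -
            deriv χ.LFunction 1 * PiW χ d r * (u + (βa - βμ)) * (u + (βb - βμ)) / (u - βμ)‖ := by
          linarith [norm_sub_norm_le
            (U (1 - βμ + u) * χ.LFunction (1 - βμ + u + βa) * χ.LFunction (1 - βμ + u + βb) /
              χ.LFunction (1 - βμ + u))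
            (deriv χ.LFunction 1 * PiW χ d r * (u + (βa - βμ)) * (u + (βb - βμ)) / (u - βμ))]
      _ ≤ Mmod + Δ := add_le_add hmod hcmp
      _ = Δ + Mmod := add_comm _ _
  -- apply the generic difference bound
  have hmain := norm_sum_log_diff_le χ U Φ f βμ βa βb (x := y) (x' := y') (ρ := ρ) (η := η)
    (α := α) (T' := (D : ℝ)) (M_c := Δ + Mmod) hχ1 hUd hβμre hβμ1 hβμ2 hΦ hy'1 hyy' hlog1 hα0 hαη
    hη40 (by linarith) hρ1 hρα hLρ hL'ρ hzf hf9 hfΦ (by positivity) hPhiR (by positivity) hPhiL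
    (by positivity) hPhiH (by positivity) hPhiC
  refine hmain.trans (le_of_eq ?_)
  rw [hΔdef, hMmod]

end Core

end Literature.NumberTheory.LFunctions.Zhang2022.Lemma84

end
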